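import Summits.BirchSwinnertonDyer.BirchSwinnertonDyer.Theorems.AlignedTransportAtTwoMainConjectureOfRankZeroBSDAtTwoFineRoadRealKummerTwist
import Summits.BirchSwinnertonDyer.BirchSwinnertonDyer.Theorems.AlignedTransportAtTwoMainConjectureOfRankZeroBSDAtTwoFineRoadRealKummerLetter
import HarnessLib

/-!
# Halves of `T_{max}` are FIXED by complex conjugation, so `T_{max}` spans the ANTI-Kummer line `(c + 1)·E[2^∞] ∩ E[2]`; hence an
# isomorphism anti-equivariant at `c` — the twisting isomorphism of a NEGATIVE quadratic twist — sends `T_{min} ↦ T_{max}` and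
# MISMATCHES the Kummer letters

Cell `bsd-f1-sign2`, WIDTH-5 attach seat `bsd-line-att-p5` (gen 11) on line `birth` of crux C2 stmt-BirchSwinnertonDyer-22298
`MainConjectureOfRankZeroBSDAtTwo`; sequel of `…FineRoadRealKummerTwistLetters` / `…RealKummerTwist` (this gen) and of att-p5 g9
`…RealKummerLetter`. A `--supports 22298 --as helper` file. HONEST FRAMING: THEOREMS ONLY — no definition, no named fact, no `sorry`;
C2-NEUTRAL (stub T stays OPEN; verdict «blocked-on GreenbergMuConjectureIrreducible» untouched); BSD is NOT proved by any of this.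

WHY. `RealKummerTwist` proved (mod GV) that stub T's conclusion is constant along POSITIVE admissible twists on `Δ > 0` (and along all of
them on `Δ < 0`), because there the twisting `2`-congruence matches both letters. This file proves the complementary NEGATIVE statement
as a kernel theorem (the crux workfile's OBSERVATION «the real letter flips under negative twists»): for `d < 0` on `Δ > 0` the twisting
congruence sends the Kummer letter `T_w(V) = T_{min}(V)` to `T_{max}(W) ≠ T_{min}(W) = T_w(W)`, so the transfer theorem's hypothesis
`ψ T_w = T′_w` fails — honestly, as a statement about THIS isomorphism (for the seed cell, `Aut_Γ(E[2]) = 1` and it is the only one; not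
proved here).
* §1 a real fact (`s² = ab`, `0 < a ≠ b > 0` ⟹ `0 < s(s+a)(s+b)`).
* §2 (any field of characteristic `0`) **`smul_eq_self_of_add_self_eq_T_max`**: for `τ ∈ ker ρ̄_{E,2}` a complex conjugation under `ι`
  and `e_{i₃}` the LARGEST real abscissa, every half `Q` of `T_{i₃}` is FIXED by `τ` (halving identity ⟹ `x(Q)` real ⟹ `τQ = ±Q`;
  `τQ = −Q` would make `2y + a₁x + a₃` purely imaginary with POSITIVE real square `4s(s+a)(s+b)`) — companion of g9's
  `smul_eq_neg_of_add_self_eq_T_min`; hence **`exists_primary_smul_add_eq_T_max`**: `T_{max} ∈ (τ + 1)·E[2^∞]`.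
* §3 (`E/ℚ`, `Δ_W > 0`) **`map_kummerLetter_eq_T_max_of_smul_eq_neg`** (`e` anti-equivariant at `g` ⟹ `ψ T_w(V) = T_{max}(W)`),
  **`map_kummerLetter_ne_of_smul_eq_neg`** (`ψ T_w(V) ≠ T_w(W)`), **`map_kummerLetter_ne_of_model_twist_of_neg`** (every `e` with the
  twisting sign rule of `W = C • V^{(d)}`, `d < 0`), `exists_kummerLetters_map_ne_of_model_twist_of_neg` (existence form for any
  `H ⊇ D_w`).

References: J. H. Silverman, *AEC* 2nd ed. (2009) III.2.3, X.1 (proof of Prop. 1.4), X.2 Prop. 2.4, X.5 Cor. 5.4; J. S. Milne, *ADT* I §3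
Rem. 3.7; R. Greenberg, LNM 1716 (1999) §5 Remark p. 174; K. Matsuno, IJNT 4 (2008) §4 (the `Σ₊`-term); crux workfile
`RELAXED-COEFFICIENTS-att-p5.md` §9–§10 (cell bsd-f1-sign2).
-/

set_option autoImplicit false
-- the Theorems namespace of this sub repeats the summit name by design (D-0017 nested layout)
set_option linter.dupNamespace false

noncomputable section

open scoped Classical

namespace Summit.BirchSwinnertonDyer.BirchSwinnertonDyer.Theorems.AlignedTransportAtTwoFineRoad.RealKummerTwistFlip

open WeierstrassCurve NumberField IsDedekindDomain Field Literature.NumberTheory.EllipticCurves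
  Literature.NumberTheory.EllipticCurves.GreenbergSelmer Literature.NumberTheory.GaloisRepresentations
  Literature.NumberTheory.EllipticCurves.DokchitserDokchitser2012
  Summit.BirchSwinnertonDyer.BirchSwinnertonDyer.Theorems.AlignedTransportAtTwoFineRoad
  Summit.BirchSwinnertonDyer.BirchSwinnertonDyer.Theorems.AlignedTransportAtTwoFineRoad.RealKummerWitnessPrelim
  Summit.BirchSwinnertonDyer.BirchSwinnertonDyer.Theorems.AlignedTransportAtTwoFineRoad.RealKummerLetter
  Summit.BirchSwinnertonDyer.BirchSwinnertonDyer.Theorems.AlignedTransportAtTwoFineRoad.RealKummerTwistLetters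

/-! ## §1 A real-number fact -/

/-- If `s² = ab` with `0 < a`, `0 < b`, `a ≠ b`, then `0 < s(s + a)(s + b)` (`= ab(2s + a + b)` and `(2s)² = 4ab < (a + b)²`). [folklore] -/
theorem mul_mul_pos_of_mul_self_eq (a b s : ℝ) (ha : 0 < a) (hb : 0 < b) (hab : a ≠ b) (hs : s * s = a * b) :
    0 < s * (s + a) * (s + b) := by
  have hid : s * (s + a) * (s + b) = a * b * (2 * s + (a + b)) := by
    have : s * s * s = a * b * s := by rw [hs]
    nlinarith [this]
  have hlt : -(a + b) < 2 * s := by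
    have hsq : (2 * s) * (2 * s) < (a + b) * (a + b) := by
      have hne : (a - b) * (a - b) > 0 := mul_self_pos.2 (sub_ne_zero.2 hab)
      nlinarith
    nlinarith [mul_pos ha hb]
  rw [hid]
  exact mul_pos (mul_pos ha hb) (by linarith)

/-! ## §2 Halves of `T_{max}` are FIXED by complex conjugation (any field of characteristic `0`) -/

section Halves

variable {K : Type} [Field K] [CharZero K] (W : WeierstrassCurve K) [W.IsElliptic]

omit [CharZero K] [W.IsElliptic] in
/-- If `σ • P = −P` for an affine point `P = (x, y)`, then `σ y = −y − a₁x − a₃`. [cite: SilvermanAEC2009, III.2.3 (a) and VIII.§1] -/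
theorem smul_y_eq_negY_of_smul_some_eq_neg (σ : absoluteGaloisGroup K) {x y : AlgebraicClosure K}
    (h : (W.baseChange (AlgebraicClosure K)).toAffine.Nonsingular x y)
    (hneg : σ • (@id (geomPoints W) (Affine.Point.some x y h)) = -@id (geomPoints W) (Affine.Point.some x y h)) :
    σ • y = -y - (W.baseChange (AlgebraicClosure K)).a₁ * x - (W.baseChange (AlgebraicClosure K)).a₃ := by
  obtain ⟨h', hsmul⟩ := smul_some_eq W σ h
  rw [hsmul] at hneg
  change (Affine.Point.some (σ • x) (σ • y) h' : (W.baseChange (AlgebraicClosure K)).toAffine.Point) =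
    -Affine.Point.some x y h at hneg
  rw [Affine.Point.neg_some, Affine.Point.some.injEq] at hneg
  rw [hneg.2]
  rfl

/-- **Halves of `T_{max}` are FIXED by complex conjugation.** Let `τ ∈ ker ρ̄_{E,2}` act as complex conjugation under `ι : K̄ → ℂ`, let
`e_{i₃}` have the LARGEST real abscissa, and let `Q ∈ E(K̄)` with `2Q = T_{i₃}`. Then `τ Q = Q`: the halving identity gives
`(x(Q) − e_{i₃})² = (e_{i₃} − e_j)(e_{i₃} − e_k) > 0`, so `x(Q)` is real and `τ Q = ±Q`; `τ Q = −Q` would make `ψ = 2y + a₁x + a₃` purely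
imaginary, whereas `ψ² = 4(x − e₀)(x − e₁)(x − e₂) = 4s(s + a)(s + b) > 0` (`s = x − e_{i₃}`, `s² = ab`). Companion of att-p5 g9
`RealKummerLetter.smul_eq_neg_of_add_self_eq_T_min` (halves of `T_{min}` are ANTI-invariant).
[cite: SilvermanAEC2009, X.1 (proof of Prop. 1.4: x(½T) = e ± √((e−e′)(e−e″)))] [cite: MilneADT2006, Ch. I §3 (Rem. 3.7)] -/
theorem smul_eq_self_of_add_self_eq_T_max (hK2 : (2 : K) ≠ 0) {τ : absoluteGaloisGroup K} (hτ : τ ∈ (W.galoisRepTorsion 2).ker)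
    (ι : AlgebraicClosure K →+* ℂ) (hι : ∀ x : AlgebraicClosure K, ι (τ • x) = starRingEnd ℂ (ι x))
    {i₃ : Fin 3} (hmax : ∀ i, (ι (xT W hK2 i)).re ≤ (ι (xT W hK2 i₃)).re)
    {Q : geomPoints W} (hQ : Q + Q = (T W hK2 i₃ : geomPoints W)) : τ • Q = Q := by
  set W' := W.baseChange (AlgebraicClosure K) with hW'
  set e : Fin 3 → AlgebraicClosure K := xT W hK2 with he
  -- the abscissae are real under `ι`
  have hperm : permGal W hK2 τ = 1 := permGal_eq_one_of_mem_ker W hK2 hτ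
  have hreal : ∀ i, (ι (e i)).im = 0 := by
    intro i
    have h1 : τ • e i = e i := by rw [he, smul_xT, hperm, Equiv.Perm.one_apply]
    have h3 : starRingEnd ℂ (ι (e i)) = ι (e i) := by rw [← hι, h1]
    exact Complex.conj_eq_iff_im.mp h3
  set r : Fin 3 → ℝ := fun i ↦ (ι (e i)).re with hr
  have hιe : ∀ i, ι (e i) = ((r i : ℝ) : ℂ) := fun i ↦ Complex.ext (by simp [hr]) (by simp [hreal i])
  have hrinj : Function.Injective r := by
    intro i j hij
    apply xT_injective W hK2
    apply ι.injective
    rw [← he, hιe, hιe, hij]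
  have hs1 : ∀ j : Fin 3, j + 1 ≠ j := by decide
  have hs2 : ∀ j : Fin 3, j + 2 ≠ j := by decide
  have hs12 : ∀ j : Fin 3, j + 1 ≠ j + 2 := by decide
  -- `a = r i₃ − r(i₃+1) > 0`, `b = r i₃ − r(i₃+2) > 0`, `a ≠ b`
  have ha : 0 < r i₃ - r (i₃ + 1) := sub_pos.2 (lt_of_le_of_ne (hmax _) (fun h ↦ hs1 i₃ (hrinj h)))
  have hb : 0 < r i₃ - r (i₃ + 2) := sub_pos.2 (lt_of_le_of_ne (hmax _) (fun h ↦ hs2 i₃ (hrinj h)))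
  have hab : r i₃ - r (i₃ + 1) ≠ r i₃ - r (i₃ + 2) := fun h ↦ hs12 i₃ (hrinj (by linarith))
  -- the halving identity: `(x(Q) − e_{i₃})² = (e_{i₃} − e_{i₃+1})(e_{i₃} − e_{i₃+2})`
  have hT0 := coe_T_ne_zero W hK2 i₃
  have hT2 := coe_add_self_eq_zero W (T W hK2 i₃)
  have hQ0 : Q ≠ 0 := by
    rintro rfl
    rw [add_zero] at hQ
    exact hT0 hQ.symm
  have hhalf : (xco W Q - e i₃) * (xco W Q - e i₃) = (e i₃ - e (i₃ + 1)) * (e i₃ - e (i₃ + 2)) := by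
    have h := four_mul_sq_xco_sub_eq W hT0 hT2 hQ
    have hx : xco W (T W hK2 i₃ : geomPoints W) = e i₃ := rfl
    rw [hx, uq_xT_eq W hK2 i₃] at h
    have h4 : (4 : AlgebraicClosure K) ≠ 0 := by norm_num
    have := mul_left_cancel₀ h4 h
    rw [← pow_two]; exact this
  -- apply `ι`: `(ι x(Q) − r i₃)² = ab > 0`, so `ι x(Q)` is real
  set z : ℂ := ι (xco W Q) - (r i₃ : ℂ) with hz
  have hzz : z * z = (((r i₃ - r (i₃ + 1)) * (r i₃ - r (i₃ + 2)) : ℝ) : ℂ) := by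
    have h := congrArg ι hhalf
    rw [map_mul, map_sub, map_mul, map_sub, map_sub, hιe, hιe, hιe] at h
    rw [hz, h]
    push_cast
    ring
  have hzim : z.im = 0 := im_eq_zero_of_mul_self_eq_ofReal (mul_pos ha hb) hzz
  have hxim : (ι (xco W Q)).im = 0 := by
    have : (ι (xco W Q)).im = z.im + ((r i₃ : ℝ) : ℂ).im := by rw [hz]; simp
    rw [this, hzim, Complex.ofReal_im, add_zero]
  have hxfix : τ • xco W Q = xco W Q := by
    apply ι.injective
    rw [hι]
    exact Complex.conj_eq_iff_im.mpr hxim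
  -- `τ Q = ± Q`
  have hτQ0 : τ • Q ≠ 0 := by
    intro h
    apply hQ0
    have := congrArg (fun P ↦ τ⁻¹ • P) h
    simpa using this
  rcases eq_or_eq_neg_of_xco_eq W hτQ0 hQ0 (by rw [xco_smul, hxfix]) with hfix | hneg
  · exact hfix
  · -- `τ Q = −Q` is impossible: `ψ = 2y + a₁x + a₃` would be purely imaginary, but `ψ² = 4s(s+a)(s+b) > 0`
    exfalso
    change W'.toAffine.Point at Q
    rcases Q with _ | ⟨x, y, hxy⟩
    · exact hQ0 rfl
    have hyneg : τ • y = -y - W'.a₁ * x - W'.a₃ := smul_y_eq_negY_of_smul_some_eq_neg W τ hxy hneg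
    have hxQ : xco W (Affine.Point.some x y hxy : geomPoints W) = x := rfl
    rw [hxQ] at hxim hhalf hz hxfix
    -- `ψ = 2y + a₁x + a₃` is anti-invariant, hence purely imaginary under `ι`
    set ψ : AlgebraicClosure K := 2 * y + W'.a₁ * x + W'.a₃ with hψ
    have ha₁ : τ • W'.a₁ = W'.a₁ := by
      rw [hW', baseChange, map_a₁, absoluteGaloisGroup.smul_def]
      exact (absoluteGaloisGroup.toAlgEquiv K τ).commutes W.a₁
    have ha₃ : τ • W'.a₃ = W'.a₃ := by
      rw [hW', baseChange, map_a₃, absoluteGaloisGroup.smul_def]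
      exact (absoluteGaloisGroup.toAlgEquiv K τ).commutes W.a₃
    have hψτ : τ • ψ = -ψ := by
      have h2 : τ • (2 : AlgebraicClosure K) = 2 := by rw [absoluteGaloisGroup.smul_def, map_ofNat]
      rw [hψ, smul_add, smul_add, smul_mul', smul_mul', hyneg, ha₁, ha₃, hxfix, h2]
      ring
    have hψre : (ι ψ).re = 0 := by
      have h3 : starRingEnd ℂ (ι ψ) = -ι ψ := by rw [← hι, hψτ, map_neg]
      have := congrArg Complex.re h3
      rw [Complex.conj_re, Complex.neg_re] at this
      linarith
    -- `ψ² = 4 ∏ (x − eᵢ)` and its `ι`-image is `4 s (s+a)(s+b) > 0`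
    have hsq := psi_sq_eq_four_mul_prod W hK2 hxy.1
    rw [prod_sub_xT_eq W hK2 x i₃] at hsq
    set s : ℝ := (ι x).re - r i₃ with hsdef
    have hιx : ι x = (((ι x).re : ℝ) : ℂ) := Complex.ext (by simp) (by simp [hxim])
    have hss : s * s = (r i₃ - r (i₃ + 1)) * (r i₃ - r (i₃ + 2)) := by
      have hzs : z = (s : ℂ) := by rw [hz, hιx, hsdef]; push_cast; ring
      have h := hzz
      rw [hzs] at h
      exact_mod_cast h
    have hpos := mul_mul_pos_of_mul_self_eq _ _ s ha hb hab hss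
    have hιψ : ι ψ * ι ψ = ((4 * (s * (s + (r i₃ - r (i₃ + 1))) * (s + (r i₃ - r (i₃ + 2)))) : ℝ) : ℂ) := by
      rw [← map_mul, ← pow_two, hψ, hsq, map_mul, map_ofNat, map_mul, map_mul, map_sub, map_sub, map_sub, hιe, hιe, hιe, hιx,
        hsdef]
      push_cast
      ring
    have hre := congrArg Complex.re hιψ
    rw [Complex.mul_re, hψre, zero_mul, zero_sub, Complex.ofReal_re] at hre
    nlinarith [mul_self_nonneg (ι ψ).im]

/-- Hence `τ Q + Q = T_{max}` for every half `Q` of `T_{max}`. [cite: SilvermanAEC2009, X.1 (proof of Prop. 1.4)] -/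
theorem smul_add_eq_T_max (hK2 : (2 : K) ≠ 0) {τ : absoluteGaloisGroup K} (hτ : τ ∈ (W.galoisRepTorsion 2).ker)
    (ι : AlgebraicClosure K →+* ℂ) (hι : ∀ x : AlgebraicClosure K, ι (τ • x) = starRingEnd ℂ (ι x))
    {i₃ : Fin 3} (hmax : ∀ i, (ι (xT W hK2 i)).re ≤ (ι (xT W hK2 i₃)).re)
    {Q : geomPoints W} (hQ : Q + Q = (T W hK2 i₃ : geomPoints W)) : τ • Q + Q = (T W hK2 i₃ : geomPoints W) := by
  rw [smul_eq_self_of_add_self_eq_T_max W hK2 hτ ι hι hmax hQ, hQ]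

/-- **`T_{max}` lies on the ANTI-Kummer line `(τ + 1)·E[2^∞]`**: there is `a ∈ E[2^∞]` (a half of `T_{max}`) with `τ a + a = T_{max}`.
Contrast att-p5 g9: `T_{min}` spans the Kummer line `(τ − 1)·E[2^∞] ∩ E[2]`. [cite: MilneADT2006, Ch. I §3 (Rem. 3.7)]
[cite: SilvermanAEC2009, X.1 (proof of Prop. 1.4)] -/
theorem exists_primary_smul_add_eq_T_max (hK2 : (2 : K) ≠ 0) {τ : absoluteGaloisGroup K} (hτ : τ ∈ (W.galoisRepTorsion 2).ker)
    (ι : AlgebraicClosure K →+* ℂ) (hι : ∀ x : AlgebraicClosure K, ι (τ • x) = starRingEnd ℂ (ι x))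
    {i₃ : Fin 3} (hmax : ∀ i, (ι (xT W hK2 i)).re ≤ (ι (xT W hK2 i₃)).re) :
    ∃ a : ↥(W.geomPrimaryTorsion 2), τ • a + a =
      AddSubgroup.inclusion (geomTorsion_le_geomPrimaryTorsion W 2) (T W hK2 i₃) := by
  obtain ⟨a, ha⟩ := W.exists_nsmul_eq_geomPrimaryTorsion 2 W.zsmul_geomPoints_surjective_holds
    (AddSubgroup.inclusion (geomTorsion_le_geomPrimaryTorsion W 2) (T W hK2 i₃))
  refine ⟨a, Subtype.ext ?_⟩
  have hQ : (a : geomPoints W) + a = (T W hK2 i₃ : geomPoints W) := by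
    have := congrArg Subtype.val ha
    simpa [two_nsmul] using this
  have h := smul_add_eq_T_max W hK2 hτ ι hι hmax hQ
  simpa [primaryComponent.coe_smul] using h

end Halves

/-! ## §3 `E/ℚ`, `Δ > 0`: an isomorphism ANTI-equivariant at complex conjugation MISMATCHES the Kummer letters (negative twists) -/

section Rat

variable (V W : WeierstrassCurve ℚ) [V.IsElliptic] [W.IsElliptic] (H : Subgroup (absoluteGaloisGroup ℚ)) (w : InfinitePlace ℚ)

omit [V.IsElliptic] in
/-- **An isomorphism anti-equivariant at complex conjugation sends the Kummer letter of `V` to the letter of `W` with the LARGEST real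
abscissa.** `Δ_W > 0`; `g ∈ H ⊓ D_w` non-trivial, a complex conjugation under `ι`; `e : V[2^∞] ≃+ W[2^∞]` additive with
`e(g a) = −g e(a)`, `ψ` its restriction to the `2`-torsion; `T_w` the Kummer letter of `V` at `g` (the `2`-torsion point spanning
`(g − 1)·V[2^∞] ∩ V[2]`). Then `ψ T_w = T_{i₃}(W)`, `ι e_{i₃}` the largest abscissa: `ψ T_w` spans the anti-Kummer line of `W`
(`RealKummerTwistLetters.antiKummerLine_iff_of_smul_eq_neg`) and `T_{max}(W)` lies on it (§2). [cite: GreenbergLNM1716, §5 Remark p. 174]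
[cite: SilvermanAEC2009, X.1 (Prop. 1.4) and X.5 Cor. 5.4] -/
theorem map_kummerLetter_eq_T_max_of_smul_eq_neg (hΔ' : 0 < W.Δ) {g : ↥(H ⊓ decompInf w)}
    (ι : AlgebraicClosure ℚ →+* ℂ) (hι : ∀ x : AlgebraicClosure ℚ, ι ((g : absoluteGaloisGroup ℚ) • x) = starRingEnd ℂ (ι x))
    {i₃ : Fin 3} (hmax : ∀ i, (ι (xT W two_ne_zero i)).re ≤ (ι (xT W two_ne_zero i₃)).re)
    (e : ↥(V.geomPrimaryTorsion 2) ≃+ ↥(W.geomPrimaryTorsion 2)) (ψ : ↥(V.geomTorsion 2) ≃+ ↥(W.geomTorsion 2))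
    (hψe : ∀ t : ↥(V.geomTorsion 2), AddSubgroup.inclusion (geomTorsion_le_geomPrimaryTorsion W 2) (ψ t) =
      e (AddSubgroup.inclusion (geomTorsion_le_geomPrimaryTorsion V 2) t))
    (hanti : ∀ a, e ((g : absoluteGaloisGroup ℚ) • a) = -((g : absoluteGaloisGroup ℚ) • e a)) {Tw : ↥(V.geomTorsion 2)}
    (hline : ∀ t : ↥(V.geomTorsion 2),
      (∃ a : ↥(V.geomPrimaryTorsion 2), (g : absoluteGaloisGroup ℚ) • a - a =
          AddSubgroup.inclusion (geomTorsion_le_geomPrimaryTorsion V 2) t) ↔ (t = 0 ∨ t = Tw)) :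
    ψ Tw = T W two_ne_zero i₃ := by
  have hgker' : (g : absoluteGaloisGroup ℚ) ∈ (W.galoisRepTorsion 2).ker :=
    PerfectDescent.mem_ker_galoisRepTorsion_two_of_forall_smul_eq W
      (fun m ↦ RealKummerWitness.forall_smul_eq_of_Δ_pos W hΔ' w _ (Subgroup.mem_inf.1 g.2).2 m)
  obtain ⟨a, ha⟩ := exists_primary_smul_add_eq_T_max W two_ne_zero hgker' ι hι hmax
  rcases (antiKummerLine_iff_of_smul_eq_neg V W e ψ hψe hanti hline (T W two_ne_zero i₃)).1 ⟨a, ha⟩ with h0 | h3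
  · exact absurd h0 (ThetaPartnerXRoute.T_ne_zero' two_ne_zero W i₃)
  · exact h3.symm

omit [V.IsElliptic] in
/-- **MISMATCH OF THE KUMMER LETTERS along an isomorphism anti-equivariant at complex conjugation.** `Δ_W > 0`, `g ∈ H ⊓ D_w`
non-trivial, `e : V[2^∞] ≃+ W[2^∞]` additive with `e(g a) = −g e(a)`, `ψ` its restriction, `T_w(V)`, `T_w(W)` the Kummer letters at `g`
(spanning `(g − 1)·E[2^∞] ∩ E[2]`). Then `ψ T_w(V) ≠ T_w(W)`: the former is `T_{max}(W)` (previous theorem), the latter `T_{min}(W)` (att-p5 g9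
`RealKummerLetter.kummerLetter_eq_T_min`). So the hypothesis `ψ T_w = T′_w` of att-p5 g10's transfer
`RealKummerCongruence.finite_twoTorsion_selmerInfty_iff_of_torsionIso_of_GV` FAILS for such `ψ`. [cite: GreenbergLNM1716, §5 Remark p. 174]
[cite: SilvermanAEC2009, X.1 (Prop. 1.4) and X.5 Cor. 5.4] -/
theorem map_kummerLetter_ne_of_smul_eq_neg (hΔ' : 0 < W.Δ) {g : ↥(H ⊓ decompInf w)} (hg : g ≠ 1)
    (e : ↥(V.geomPrimaryTorsion 2) ≃+ ↥(W.geomPrimaryTorsion 2)) (ψ : ↥(V.geomTorsion 2) ≃+ ↥(W.geomTorsion 2))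
    (hψe : ∀ t : ↥(V.geomTorsion 2), AddSubgroup.inclusion (geomTorsion_le_geomPrimaryTorsion W 2) (ψ t) =
      e (AddSubgroup.inclusion (geomTorsion_le_geomPrimaryTorsion V 2) t))
    (hanti : ∀ a, e ((g : absoluteGaloisGroup ℚ) • a) = -((g : absoluteGaloisGroup ℚ) • e a)) {Tw : ↥(V.geomTorsion 2)}
    (hline : ∀ t : ↥(V.geomTorsion 2),
      (∃ a : ↥(V.geomPrimaryTorsion 2), (g : absoluteGaloisGroup ℚ) • a - a =
          AddSubgroup.inclusion (geomTorsion_le_geomPrimaryTorsion V 2) t) ↔ (t = 0 ∨ t = Tw))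
    {Tw' : ↥(W.geomTorsion 2)}
    (hline' : ∀ t' : ↥(W.geomTorsion 2),
      (∃ a' : ↥(W.geomPrimaryTorsion 2), (g : absoluteGaloisGroup ℚ) • a' - a' =
          AddSubgroup.inclusion (geomTorsion_le_geomPrimaryTorsion W 2) t') ↔ (t' = 0 ∨ t' = Tw')) :
    ψ Tw ≠ Tw' := by
  have hgker' : (g : absoluteGaloisGroup ℚ) ∈ (W.galoisRepTorsion 2).ker :=
    PerfectDescent.mem_ker_galoisRepTorsion_two_of_forall_smul_eq W
      (fun m ↦ RealKummerWitness.forall_smul_eq_of_Δ_pos W hΔ' w _ (Subgroup.mem_inf.1 g.2).2 m)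
  obtain ⟨ι, hι⟩ := RealKummerIndex.exists_embedding_of_ne_one (IsTotallyReal.isReal w) H hg
  obtain ⟨i₁, i₃, hne, hmin, hmax, -, -⟩ :=
    RealKummerValues.exists_classes_apply_eq_T_min_max W two_ne_zero H (τ := (g : absoluteGaloisGroup ℚ)) ⟨g.2.1, hgker'⟩ ι hι
  rw [map_kummerLetter_eq_T_max_of_smul_eq_neg V W H w hΔ' ι hι hmax e ψ hψe hanti hline,
    kummerLetter_eq_T_min W H w hgker' ι hι hmin hline']
  exact fun h ↦ hne (T_injective W two_ne_zero h).symm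

/-- **NEGATIVE TWISTS MISMATCH THE KUMMER LETTERS.** `V/ℚ` with `Δ_V > 0`, `W = C • V^{(d)}` a `ℚ`-model of the quadratic twist with
`d < 0`, `e : V[2^∞] ≃+ W[2^∞]` ANY additive isomorphism obeying the twisting sign rule «anti-equivariant wherever `σ√d = −√d`» (e.g. the
tree's `Additive.exists_addEquiv_geomPrimaryTorsion_of_model_twist_sign`), `ψ` its restriction to the `2`-torsion, `g ∈ H ⊓ D_w` a
complex conjugation, `T_w(V)`, `T_w(W)` the Kummer letters. Then `ψ T_w(V) ≠ T_w(W)` — every non-trivial element of the real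
decomposition group negates `√d` (`RealKummerTwist.smul_geomSqrt_of_mem_decompInf_of_neg`), so `e` is anti-equivariant there. This is the
kernel form of the OBSERVATION of the crux workfile §9: the real letter FLIPS (`T_{min} ↦ T_{max}`) under negative twists, so the p = 2
Greenberg–Vatsal transfer of att-p5 g10 does not relate `V` and `V^{(d)}` for `d < 0` on `Δ > 0` (in contrast with `d > 0`, and with
`Δ < 0` where no real letter exists: `RealKummerTwist`). [cite: GreenbergLNM1716, §5 Remark p. 174]
[cite: SilvermanAEC2009, X.5 Cor. 5.4 and X.2 Prop. 2.4] -/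
theorem map_kummerLetter_ne_of_model_twist_of_neg (hΔpos : 0 < V.Δ) {d : ℚ} (hd : d < 0) {C : VariableChange ℚ}
    (hC : C • V.quadraticTwist d = W) (e : ↥(V.geomPrimaryTorsion 2) ≃+ ↥(W.geomPrimaryTorsion 2))
    (hneg : ∀ σ : absoluteGaloisGroup ℚ, σ • geomSqrt d = -geomSqrt d → ∀ m, e (σ • m) = -(σ • e m))
    (ψ : ↥(V.geomTorsion 2) ≃+ ↥(W.geomTorsion 2))
    (hψe : ∀ t : ↥(V.geomTorsion 2), AddSubgroup.inclusion (geomTorsion_le_geomPrimaryTorsion W 2) (ψ t) =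
      e (AddSubgroup.inclusion (geomTorsion_le_geomPrimaryTorsion V 2) t))
    {g : ↥(H ⊓ decompInf w)} (hg : g ≠ 1) {Tw : ↥(V.geomTorsion 2)}
    (hline : ∀ t : ↥(V.geomTorsion 2),
      (∃ a : ↥(V.geomPrimaryTorsion 2), (g : absoluteGaloisGroup ℚ) • a - a =
          AddSubgroup.inclusion (geomTorsion_le_geomPrimaryTorsion V 2) t) ↔ (t = 0 ∨ t = Tw))
    {Tw' : ↥(W.geomTorsion 2)}
    (hline' : ∀ t' : ↥(W.geomTorsion 2),
      (∃ a' : ↥(W.geomPrimaryTorsion 2), (g : absoluteGaloisGroup ℚ) • a' - a' =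
          AddSubgroup.inclusion (geomTorsion_le_geomPrimaryTorsion W 2) t') ↔ (t' = 0 ∨ t' = Tw')) :
    ψ Tw ≠ Tw' := by
  have hΔ' : 0 < W.Δ := (RealKummerTwist.Δ_pos_iff_of_model_twist V W hd.ne hC).2 hΔpos
  have hg1 : (g : absoluteGaloisGroup ℚ) ≠ 1 := fun h ↦ hg (Subtype.ext h)
  have hanti : ∀ a, e ((g : absoluteGaloisGroup ℚ) • a) = -((g : absoluteGaloisGroup ℚ) • e a) :=
    hneg _ (RealKummerTwist.smul_geomSqrt_of_mem_decompInf_of_neg hd w _ (Subgroup.mem_inf.1 g.2).2 hg1)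
  exact map_kummerLetter_ne_of_smul_eq_neg V W H w hΔ' hg e ψ hψe hanti hline hline'

/-- **Existence form**: for `Δ_V > 0`, a `ℚ`-model `W = C • V^{(d)}` with `d < 0`, and ANY `H ≤ Γ_ℚ` containing the real decomposition group
(e.g. `Γ_ℚ`, `Gal(ℚ̄/ℚ_∞)`, `Gal(ℚ̄/ℚ_n)`), there are a complex conjugation `g ∈ H ⊓ D_w`, the two Kummer letters `T_w(V)`, `T_w(W)` at `g`, and
for EVERY isomorphism `e : V[2^∞] ≃+ W[2^∞]` with the twisting sign rule the restriction `ψ` has `ψ T_w(V) ≠ T_w(W)`.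
[cite: GreenbergLNM1716, §5 Remark p. 174] [cite: SilvermanAEC2009, X.5 Cor. 5.4] -/
theorem exists_kummerLetters_map_ne_of_model_twist_of_neg (hΔpos : 0 < V.Δ) {d : ℚ} (hd : d < 0) {C : VariableChange ℚ}
    (hC : C • V.quadraticTwist d = W) (hH : decompInf w ≤ H) :
    ∃ g : ↥(H ⊓ decompInf w), g ≠ 1 ∧ ∃ (Tw : ↥(V.geomTorsion 2)) (Tw' : ↥(W.geomTorsion 2)), Tw ≠ 0 ∧ Tw' ≠ 0 ∧
      (∀ t : ↥(V.geomTorsion 2),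
        (∃ a : ↥(V.geomPrimaryTorsion 2), (g : absoluteGaloisGroup ℚ) • a - a =
            AddSubgroup.inclusion (geomTorsion_le_geomPrimaryTorsion V 2) t) ↔ (t = 0 ∨ t = Tw)) ∧
      (∀ t' : ↥(W.geomTorsion 2),
        (∃ a' : ↥(W.geomPrimaryTorsion 2), (g : absoluteGaloisGroup ℚ) • a' - a' =
            AddSubgroup.inclusion (geomTorsion_le_geomPrimaryTorsion W 2) t') ↔ (t' = 0 ∨ t' = Tw')) ∧
      ∀ (e : ↥(V.geomPrimaryTorsion 2) ≃+ ↥(W.geomPrimaryTorsion 2)),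
        (∀ σ : absoluteGaloisGroup ℚ, σ • geomSqrt d = -geomSqrt d → ∀ m, e (σ • m) = -(σ • e m)) →
        ∀ ψ : ↥(V.geomTorsion 2) ≃+ ↥(W.geomTorsion 2),
          (∀ t : ↥(V.geomTorsion 2), AddSubgroup.inclusion (geomTorsion_le_geomPrimaryTorsion W 2) (ψ t) =
            e (AddSubgroup.inclusion (geomTorsion_le_geomPrimaryTorsion V 2) t)) → ψ Tw ≠ Tw' := by
  have hΔ' : 0 < W.Δ := (RealKummerTwist.Δ_pos_iff_of_model_twist V W hd.ne hC).2 hΔpos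
  obtain ⟨g, hg⟩ := RealKummerIndex.exists_ne_one_inf_decompInf (IsTotallyReal.isReal w) H hH
  obtain ⟨Tw, hTw0, hline⟩ := RealKummerLine.exists_kummerLetter V H w hΔpos hg
  obtain ⟨Tw', hTw0', hline'⟩ := RealKummerLine.exists_kummerLetter W H w hΔ' hg
  exact ⟨g, hg, Tw, Tw', hTw0, hTw0', hline, hline', fun e hneg ψ hψe ↦
    map_kummerLetter_ne_of_model_twist_of_neg V W H w hΔpos hd hC e hneg ψ hψe hg hline hline'⟩

end Rat

end Summit.BirchSwinnertonDyer.BirchSwinnertonDyer.Theorems.AlignedTransportAtTwoFineRoad.RealKummerTwistFlip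

end
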